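import Literature.AnabelianGeometry.EtaleTheta.TemperedRigidityValuation
import Literature.AnabelianGeometry.EtaleTheta.Discharge.Sec1CompatHolds
import Literature.AnabelianGeometry.EtaleTheta.Discharge.Sec1Prop18
import Literature.AnabelianGeometry.EtaleTheta.SettingModelMuTwo
import HarnessLib

/-!
# NON-VACUITY of [EtTh] Thm. 1.10's hypothesis structure `Thm110Hypothesis`: the identity witness,
# at every `MuTwoSetting` and at the root model

Mochizuki, *The étale theta function …* [EtTh], Publ. RIMS **45** (2009), Thm. 1.10 p.255–256 (PRIMS PDF
pp.29–30) [cite: MochizukiEtTh2009, Thm 1.10 p.29].  abc-iut cell, layer L2, NV-L2 row family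
«NV-L2/Thm110Hypothesis» (abc-iut-L2-lead gen 3, L2 DEFS-FREEZE posture 04:46:23Z (C): holder w5-d062 g2
with abc-iut-L2-t6 g4; seat abc-iut-w5-d062 gen 2).

`MuTwoSetting.Thm110Hypothesis εα εβ hCα hCβ Eα Eβ γ` (ConstantMultipleRigidity.lean, abc-iut-L2-t1) is
the hypothesis structure over which `Thm110i`, `Thm110iUnique`'s consumers, `Thm110ii`, `Thm110iii`,
`Thm110iiiGalSect` are stated ("Let `γ : Π^tp_{Ċα} ⥲ Π^tp_{Ċβ}` be an isomorphism … Suppose that the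
isomorphism `Π^tp_{Xα} ⥲ Π^tp_{Xβ}` induced by `γ` maps `η̈^{Θ,Z}_α ↦ η̈^{Θ,Z}_β`", p.255–256).  This file
shows it is INHABITED in the kernel (PROOF-ONLY file: no definitions, no named facts):

* `Thm110Hypothesis.nonempty_refl` — for ANY `M : MuTwoSetting p`, admissible `ε_Z`, `hC : Compat`,
  `E : EtaleThetaData`: the IDENTITY `γ = id : Π^tp_Ċ ⥲ Π^tp_Ċ` (`α = β`) carries the structure, with
  `Γ = id`, `γ_X = id`, the identity theta companion (abc-iut-L2-t1's `ThetaCompanion.ofRefl`,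
  `thm16i_refl`) and `maps_orbit` from `transport_refl` (transport along the identity is the identity);
* `Thm110Hypothesis.nonempty_of` — hence `Nonempty (Thm110Hypothesis εZ εZ M.compat M.compat E E id)`
  for every admissible `εZ` (such exist: `MuTwoSetting.exists_isAdmissibleEpsZ`, Discharge/Sec1Prop18;
  `Compat` holds for every setting: `ThetaSetting.compat`, Discharge/Sec1CompatHolds);
* `Thm110Hypothesis.nonempty_model` — at the ROOT MODEL `MuTwoSetting.model p` (abc-iut-L2-t1,
  SettingModelMuTwo) with its admissible `ε_Z := a` (`model_isAdmissibleEpsZ`), for every étale theta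
  datum `E` over it.

CENSUS TOKEN (for w5-d085's NV-L2 triage): `Thm110Hypothesis` = INHABITED RELATIVE TO ITS PARAMETER
`E : EtaleThetaData` (the identity witness needs no further genuine input); its non-vacuity at the model
therefore REDUCES EXACTLY to the NV row of `EtaleThetaData` (map: «OPEN after triage, L6-t1/t8
EtaleThetaDataOfSetting lineage»).  This is consistency evidence only (the identity is not an interesting
`γ`); nothing of [EtTh] is asserted; no side taken on [IUTchIII] Cor. 3.12.
-/

noncomputable section

namespace Literature.AnabelianGeometry.EtaleTheta

namespace MuTwoSetting

variable {p : ℕ} [Fact p.Prime] (M : MuTwoSetting p)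

/-- The identity preserves the coverings of Prop. 1.8. [cite: MochizukiEtTh2009, Prop 1.8 p.28] -/
theorem preservesCoverings_refl (εZ : M.GtpC) :
    PreservesCoverings εZ εZ (ContinuousMulEquiv.refl M.GtpC) where
  map_Ydd := Subgroup.map_id _
  map_Xdd := Subgroup.map_id _
  map_dotX := Subgroup.map_id _
  map_X := Subgroup.map_id _
  map_dotC := Subgroup.map_id _

/-- **The identity witness of `Thm110Hypothesis`** (`α = β`, `γ = id`, `Γ = id`, `γ_X = id`, identity
theta companion `ThetaCompanion.ofRefl`, `thm16i_refl`, `η̈^{Θ,Z} ↦ η̈^{Θ,Z}` by `transport_refl`):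
`Thm110Hypothesis` is INHABITED at every `MuTwoSetting`, for every admissible `ε_Z`, every `hC : Compat`
(which HOLDS: `ThetaSetting.compat`) and every étale theta datum `E`. [cite: MochizukiEtTh2009, Thm 1.10 p.29] -/
theorem Thm110Hypothesis.nonempty_refl {εZ : M.GtpC} (hZ : M.IsAdmissibleEpsZ εZ)
    (hC : M.toThetaSetting.Compat) (E : M.toThetaSetting.EtaleThetaData) :
    Nonempty (Thm110Hypothesis εZ εZ hC hC E E (ContinuousMulEquiv.refl (M.dotC εZ))) :=
  ⟨{ admα := hZ
     admβ := hZ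
     Γ := ContinuousMulEquiv.refl M.GtpC
     preserves := M.preservesCoverings_refl εZ
     restricts := ⟨1, fun x => by rw [inv_one, mul_one, one_mul]; rfl⟩
     γX := ContinuousMulEquiv.refl M.PiTemp
     γX_spec := fun _ => rfl
     thm16i := ThetaSetting.thm16i_refl M.toThetaSetting
     companion := ThetaSetting.ThetaCompanion.ofRefl M.toThetaSetting
     maps_orbit := fun y => by
       constructor
       · intro hy
         exact ⟨y, hy, (ThetaSetting.transport_refl _ _ y).symm⟩
       · rintro ⟨x, hx, rfl⟩
         rw [ThetaSetting.transport_refl]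
         exact hx }⟩

/-- … with the tree's proof of `Compat` (`ThetaSetting.compat`, Discharge/Sec1CompatHolds) plugged in.
[cite: MochizukiEtTh2009, Thm 1.10 p.29] -/
theorem Thm110Hypothesis.nonempty_of {εZ : M.GtpC} (hZ : M.IsAdmissibleEpsZ εZ)
    (E : M.toThetaSetting.EtaleThetaData) :
    Nonempty (Thm110Hypothesis εZ εZ M.toThetaSetting.compat M.toThetaSetting.compat E E
      (ContinuousMulEquiv.refl (M.dotC εZ))) :=
  Thm110Hypothesis.nonempty_refl M hZ _ E

/-- … in particular for SOME admissible `ε_Z` (`exists_isAdmissibleEpsZ`, Def. 1.7 non-vacuity).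
[cite: MochizukiEtTh2009, Thm 1.10 p.29] -/
theorem Thm110Hypothesis.exists_nonempty (E : M.toThetaSetting.EtaleThetaData) :
    ∃ εZ : M.GtpC, M.IsAdmissibleEpsZ εZ ∧
      Nonempty (Thm110Hypothesis εZ εZ M.toThetaSetting.compat M.toThetaSetting.compat E E
        (ContinuousMulEquiv.refl (M.dotC εZ))) := by
  obtain ⟨εZ, hZ⟩ := M.exists_isAdmissibleEpsZ
  exact ⟨εZ, hZ, Thm110Hypothesis.nonempty_of M hZ E⟩

/-- **At the root model** `MuTwoSetting.model p` (abc-iut-L2-t1's `SettingModelMuTwo`; an admissible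
`ε_Z` exists there, e.g. `ε_Z := a`, `model_isAdmissibleEpsZ`): `Thm110Hypothesis` is inhabited for every
étale theta datum `E` over the model — so the NV question for `Thm110Hypothesis` at the model reduces
exactly to that for `EtaleThetaData`. [cite: MochizukiEtTh2009, Thm 1.10 p.29] -/
theorem Thm110Hypothesis.nonempty_model
    (E : (MuTwoSetting.model p).toThetaSetting.EtaleThetaData) :
    ∃ εZ : (MuTwoSetting.model p).GtpC, (MuTwoSetting.model p).IsAdmissibleEpsZ εZ ∧
      Nonempty (Thm110Hypothesis εZ εZ (MuTwoSetting.model p).toThetaSetting.compat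
        (MuTwoSetting.model p).toThetaSetting.compat E E
        (ContinuousMulEquiv.refl ((MuTwoSetting.model p).dotC εZ))) :=
  Thm110Hypothesis.exists_nonempty (MuTwoSetting.model p) E

end MuTwoSetting

end Literature.AnabelianGeometry.EtaleTheta

end
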